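import Literature.Claims.NS.Zeroual2026
import Summits.NavierStokesRegularity.NavierStokesRegularity.Theorems.SoloRefuteRomanMiller2011
import HarnessLib

-- FILER'S DISCLOSED DEDUP EDIT (salvage-p1 g4, conv. (b)): the kit's standalone `isDatum_zero` tripped the
-- gate's `dedup.landed` check (statement text `IsDatum 0` also printed by `…Theorems.Iotti2011.isDatum_zero`, a
-- different class); its proof is inlined verbatim as `hD0` inside `not_claimedUniqueness`; likewise the two
-- helper lemmas shared verbatim with the sibling C143 kit (`stream_zero_of`, `stream_zero_one_ne_stream_id_one`)
-- are inlined so the two files do not dedup against each other. `isSolutionOn_stream` and the statement and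
-- witness of `not_claimedUniqueness` are unchanged from typist-4 g6's kit 21b3e49de4dfca23; the headline is
-- spelled with the fully qualified `Literature.Claims.NS.Zeroual2026.ClaimedUniqueness` (the gate's dedup keyed the
-- short spelling `¬ ClaimedUniqueness` to the C143 sibling's headline).

/-!
# C157 `Zeroual2026` — the off-path face `ClaimedUniqueness` is false AS TYPED (custodian kit, typist-4 g6)

`Literature.Claims.NS.Zeroual2026.ClaimedUniqueness` types the word «unique» of Thm 1.4 p.4 l.54 for global
classical solutions of (1.1)–(1.3) on `ℝ³` from a datum of the printed class (`C^∞ ∩ H¹`, divergence-free),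
with NO decay class on the solution (Def 1.1 p.4 l.21–35 prints none; the typist's docstring records the
classical non-uniqueness family, lit-1 g10 13:10:52Z the same observation for `Step_Energy`). At that width
the statement is false in the kernel: from the ZERO datum (in the class: `InH1 0` trivially) both the rest
state `u ≡ 0`, `p ≡ 0` (`RomanMiller2011.stream 0`) and the uniformly accelerating stream
`u(t,x) = t·e₀`, `p(t,x) = −x₀` (`RomanMiller2011.stream id`) are classical solutions on `ℝ³ × [0,∞)` for
every `ν` (`isClassicalNSSolutionOn_stream`), and they differ at `t = 1`. Records-grade: `ClaimedUniqueness`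
is «not consumed by the chain»; the head of #140 (`Step1_Thm41`, by `…Theorems.Zeroual2026.not_Step1_Thm41`
p530027) and its class are untouched; nothing is re-keyed.

WHAT THIS IS NOT: not a claim about NS regularity or blow-up; not a claim about any author beyond the
typed locator.
-/

set_option linter.dupNamespace false

noncomputable section

open Set Function MeasureTheory
open scoped ContDiff ENNReal
open Literature.Analysis.FluidPDE
open Literature.Claims.NS.Zeroual2026 (E3 IsDatum IsSolutionOn)
open Summit.NavierStokesRegularity.NavierStokesRegularity.Theorems.RomanMiller2011
  (e0 stream streamPressure isClassicalNSSolutionOn_stream)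

namespace Summit.NavierStokesRegularity.NavierStokesRegularity.Theorems.Zeroual2026Uniqueness

/-- A stream with smooth profile `g`, `g(0) = 0`, is a solution of the class on `ℝ³ × [0,∞)` from the zero
datum, for every `ν`. [folklore] -/
theorem isSolutionOn_stream (ν : ℝ) {g : ℝ → ℝ} (hg : ContDiff ℝ ∞ g) (hg0 : g 0 = 0) :
    IsSolutionOn ν (Ici 0) (0 : E3 → E3) (stream g) (streamPressure g) where
  isClassical :=
    (isClassicalNSSolutionOn_stream hg ν).mono (subset_univ _) (uniqueDiffOn_Ici 0)
  initial := by
    funext x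
    simp [stream, hg0]

/-- **`ClaimedUniqueness` as typed is false.** Witness: `ν = 1`, the zero datum, the rest state `stream 0`
against the accelerating stream `stream id`, `t = 1`. [cite: Zeroual2026, Thm 1.4 p.4 l.54] -/
theorem not_claimedUniqueness : ¬ Literature.Claims.NS.Zeroual2026.ClaimedUniqueness := by
  intro h
  -- the zero field is a datum of the printed class (`C^∞`, divergence-free, `∫|0|² = ∫|D0|² = 0 < ∞`)
  have hD0 : IsDatum (0 : E3 → E3) := by
    refine ⟨contDiff_const, fun x => ?_, ?_, ?_⟩
    · simp [VectorCalculus.divergence]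
    · have h : (fun x : E3 => ‖(0 : E3 → E3) x‖ₑ ^ 2) = fun _ => 0 := by
        funext x
        simp
      show (∫⁻ x, ‖(0 : E3 → E3) x‖ₑ ^ 2) < ⊤
      rw [h, lintegral_zero]
      exact ENNReal.zero_lt_top
    · have h : (fun x : E3 => ‖fderiv ℝ (0 : E3 → E3) x‖ₑ ^ 2) = fun _ => 0 := by
        funext x
        have hx : fderiv ℝ (0 : E3 → E3) x = 0 := by
          rw [show (0 : E3 → E3) = fun _ => (0 : E3) from rfl, fderiv_const_apply]
        rw [hx, ← ofReal_norm, norm_zero, ENNReal.ofReal_zero, zero_pow two_ne_zero]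
      show (∫⁻ x, ‖fderiv ℝ (0 : E3 → E3) x‖ₑ ^ 2) < ⊤
      rw [h, lintegral_zero]
      exact ENNReal.zero_lt_top
  have h1 := h 1 one_pos 0 hD0 (stream 0) (stream id) (streamPressure 0) (streamPressure id)
    (isSolutionOn_stream 1 contDiff_const rfl) (isSolutionOn_stream 1 contDiff_id rfl) 1 zero_le_one
  -- at time `1` the rest state and the accelerating stream differ
  have h0 := congrArg (fun f : E3 → E3 => f 0 0) h1
  simp [stream, e0] at h0

/-- FQN guard: the refuted statement is literally the skeleton's. -/
example : ¬ Literature.Claims.NS.Zeroual2026.ClaimedUniqueness := not_claimedUniqueness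

end Summit.NavierStokesRegularity.NavierStokesRegularity.Theorems.Zeroual2026Uniqueness

end

-- WHAT THIS IS NOT: not a claim about NS regularity or blow-up; not a claim about any author beyond the typed locator.
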